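import Summits.Ventures.PercRepro.SixFourPLCov3B

/-!
# PercRepro — C-025 at `(6,4)`, step (4) of `PLJlow`, part C: the nine blocks of the double sum and the bound `≤ X̄(π)`
(mine-2; pre-cut of `SixFourPLCov3.lean` l.553–798, bodies verbatim)

The step-(4) chain of record (`MINE2-RLS.md` §21.18.9.2, PRECISION 3) is `Xcnt M G ≤ Σ_{covPairs3} 2^{|P ∩ P′ ∩ G|} ≤
X̄(profile D)` (resp. `≤ X̄′(profile D)` at `g = 8, 9`), cut into gate-sized modules: `SixFourPLCovPairs3` (the first
inequality, on the rank-3-trace planes; imports the landed `SixFourT4XA`) and `SixFourPLCov3A → SixFourPLCov3B →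
SixFourPLCov3C → SixFourPLCov3D` (the second inequality as pure finite-set statements; `SixFourPLCov3A` imports the
landed `SixFourPLList`), joined by `SixFourPLSeam` (`Xcnt_le_Xbar_seam`, `Xcnt_le_Xbar'_seam`). The bodies are those of
lean-drafts/mine-2/SixFourPLCov3.lean (1,012 lines, sha16 54cf6c11e44bf06b) verbatim; only the preambles differ.

This part: the block sums `sum_rho_pi`, `sum_pi_rho`, `sum_rho_xl`, `sum_xl_rho`, `sum_xl_xl`, `sum_pi_pi`,
`card_covPairsCL_le_covOld`, `sum_pi_xl_le_cov`, `sum_pi_xl_le`, `sum_xl_pi_le_cov`, `sum_xl_pi_le`, the disjointness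
of the listed traces (`rho_notMem`, `disjoint_piTraces_xlTraces`), `sum_covPairsOf_tracesOf_le_Xbar` and
**`sum_covPairsOf_le_Xbar_of_subset`** (the `g = 10..12` form of the second inequality). Imports `SixFourPLCov3B`.
-/

namespace PercRepro.SixFour

open Finset

variable {α : Type*} [DecidableEq α]

section accounting

variable {π : PL.CProf} {ρ L : Finset α} {C N : Finset (Finset α)}

/-! ## The nine blocks of the double sum and the bound -/

/-- T1: `Σ_j cw ρ (L ∪ λ_j) = Σ_j 2^{s_j}`. -/
theorem sum_rho_pi (h : PLTraceData π ρ L C N) :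
    ∑ S' ∈ piTraces L C, cw (ρ ∪ L) ρ S' = ∑ A ∈ C, 2 ^ A.card := by
  unfold piTraces
  rw [Finset.sum_image (injOn_union_left h.disj h.class_subset)]
  exact Finset.sum_congr rfl (fun A hA => cw_rho_pi h hA)

/-- T1 reversed. -/
theorem sum_pi_rho (h : PLTraceData π ρ L C N) :
    ∑ S ∈ piTraces L C, cw (ρ ∪ L) S ρ = ∑ A ∈ C, 2 ^ A.card := by
  unfold piTraces
  rw [Finset.sum_image (injOn_union_left h.disj h.class_subset)]
  exact Finset.sum_congr rfl (fun A hA => cw_pi_rho h hA)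

/-- T0: `Σ_{x, λ} cw ρ ({x} ∪ λ) = 0`. -/
theorem sum_rho_xl (h : PLTraceData π ρ L C N) :
    ∑ S' ∈ xlTraces L N, cw (ρ ∪ L) ρ S' = 0 := by
  unfold xlTraces
  rw [Finset.sum_image (injOn_insert h.disj h.line_subset)]
  apply Finset.sum_eq_zero
  intro q hq
  rw [Finset.mem_product] at hq
  exact cw_rho_xl h hq.2

/-- T0 reversed. -/
theorem sum_xl_rho (h : PLTraceData π ρ L C N) :
    ∑ S ∈ xlTraces L N, cw (ρ ∪ L) S ρ = 0 := by
  unfold xlTraces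
  rw [Finset.sum_image (injOn_insert h.disj h.line_subset)]
  apply Finset.sum_eq_zero
  intro q hq
  rw [Finset.mem_product] at hq
  exact cw_xl_rho h hq.2

/-- T0: `Σ cw ({x} ∪ λ) ({x′} ∪ λ′) = 0`. -/
theorem sum_xl_xl (h : PLTraceData π ρ L C N) :
    ∑ S ∈ xlTraces L N, ∑ S' ∈ xlTraces L N, cw (ρ ∪ L) S S' = 0 := by
  unfold xlTraces
  rw [Finset.sum_image (injOn_insert h.disj h.line_subset)]
  apply Finset.sum_eq_zero
  intro q hq
  rw [Finset.sum_image (injOn_insert h.disj h.line_subset)]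
  apply Finset.sum_eq_zero
  intro q' hq'
  rw [Finset.mem_product] at hq hq'
  exact cw_xl_xl h hq.2 hq'.2

/-- T2: `Σ_{j, k} cw (L ∪ λ_j) (L ∪ λ_k) = 2·2^{n+e}·#{j < k : s_j + s_k = p + e}`. -/
theorem sum_pi_pi (h : PLTraceData π ρ L C N) :
    ∑ S ∈ piTraces L C, ∑ S' ∈ piTraces L C, cw (ρ ∪ L) S S' =
      2 * (2 ^ (L.card + PL.e π) * PL.countPairs π.sizes (fun a b => a + b = π.p + PL.e π)) := by
  unfold piTraces
  rw [Finset.sum_image (injOn_union_left h.disj h.class_subset)]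
  simp only [Finset.sum_image (injOn_union_left h.disj h.class_subset)]
  have h1 : ∀ A ∈ C, ∀ B ∈ C, cw (ρ ∪ L) (L ∪ A) (L ∪ B) =
      2 ^ (L.card + PL.e π) *
        (if A ≠ B ∧ decide (A.card + B.card = π.p + PL.e π) = true then 1 else 0) := by
    intro A hA B hB
    rw [cw_pi_pi h hA hB, mul_boole]
    by_cases hne : A ≠ B
    · by_cases hc : ρ ⊆ A ∪ B
      · rw [if_pos ⟨hne, hc⟩, if_pos ⟨hne, by
          rw [decide_eq_true_eq]
          exact (rho_subset_union_iff h hA hB hne).1 hc⟩]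
      · rw [if_neg (fun h' => hc h'.2), if_neg (fun h' => hc ((rho_subset_union_iff h hA hB hne).2 (by
          have := h'.2
          rwa [decide_eq_true_eq] at this)))]
    · rw [if_neg (fun h' => hne h'.1), if_neg (fun h' => hne h'.1)]
  rw [Finset.sum_congr rfl (fun A hA => Finset.sum_congr rfl (fun B hB => h1 A hA B hB))]
  simp only [← Finset.mul_sum]
  have h2 : ∑ A ∈ C, ∑ B ∈ C, (if A ≠ B ∧ decide (A.card + B.card = π.p + PL.e π) = true then 1 else 0) =
      ((C ×ˢ C).filter fun q => q.1 ≠ q.2 ∧ decide (q.1.card + q.2.card = π.p + PL.e π) = true).card := by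
    rw [Finset.card_filter, Finset.sum_product]
  have hf : ∀ a b, decide (a + b = π.p + PL.e π) = decide (b + a = π.p + PL.e π) := by
    intro a b
    rw [Nat.add_comm]
  rw [h2, PL.card_filter_product_eq_two_mul_countPairs h.sizes_eq _ hf]
  ring

/-- The covering (class, non-class line) pairs `ρ ⊆ λ_j ∪ λ` (i.e. `ρ ∖ λ_j ⊆ λ`) — `covClassLine` of PRECISION 3 (c). -/
def covPairsCL (ρ : Finset α) (C N : Finset (Finset α)) : Finset (Finset α × Finset α) :=
  (C ×ˢ N).filter fun q => ρ ⊆ q.1 ∪ q.2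

/-- `#covPairsCL = Σ_j #{λ : ρ ⊆ λ_j ∪ λ}`. -/
theorem card_covPairsCL_eq_sum (ρ : Finset α) (C N : Finset (Finset α)) :
    (covPairsCL ρ C N).card = ∑ A ∈ C, (N.filter fun l => ρ ⊆ A ∪ l).card := by
  unfold covPairsCL
  rw [Finset.card_filter, Finset.sum_product]
  exact Finset.sum_congr rfl (fun A _ => (Finset.card_filter _ _).symm)

/-- `#covPairsCL = Σ_λ #{j : ρ ⊆ λ_j ∪ λ}`. -/
theorem card_covPairsCL_eq_sum' (ρ : Finset α) (C N : Finset (Finset α)) :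
    (covPairsCL ρ C N).card = ∑ l ∈ N, (C.filter fun A => ρ ⊆ A ∪ l).card := by
  unfold covPairsCL
  rw [Finset.card_filter, Finset.sum_product, Finset.sum_comm]
  exact Finset.sum_congr rfl (fun l _ => (Finset.card_filter _ _).symm)

/-- `#covPairsCL ≤ covOld`: at most one covering line per class, and a covered class is counted by `covOld`. -/
theorem card_covPairsCL_le_covOld (h : PLTraceData π ρ L C N) :
    (covPairsCL ρ C N).card ≤
      (C.filter fun A => 0 < PL.nu π (π.p - A.card) ∨ 0 < PL.nu π (π.p - A.card + 1)).card := by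
  rw [card_covPairsCL_eq_sum, Finset.card_filter]
  exact Finset.sum_le_sum (fun A hA => card_filter_cov_le h hA)

/-- T3: `Σ_j Σ_{x, λ} cw (L ∪ λ_j) ({x} ∪ λ) ≤ 4n·#covPairsCL`. -/
theorem sum_pi_xl_le_cov (h : PLTraceData π ρ L C N) :
    ∑ S ∈ piTraces L C, ∑ S' ∈ xlTraces L N, cw (ρ ∪ L) S S' ≤ 4 * L.card * (covPairsCL ρ C N).card := by
  unfold piTraces xlTraces
  rw [Finset.sum_image (injOn_union_left h.disj h.class_subset)]
  simp only [Finset.sum_image (injOn_insert h.disj h.line_subset)]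
  calc ∑ A ∈ C, ∑ q ∈ L ×ˢ N, cw (ρ ∪ L) (L ∪ A) (insert q.1 q.2)
      ≤ ∑ A ∈ C, ∑ q ∈ L ×ˢ N, (if ρ ⊆ A ∪ q.2 then 4 else 0) := by
        apply Finset.sum_le_sum
        intro A hA
        apply Finset.sum_le_sum
        intro q hq
        rw [Finset.mem_product] at hq
        exact cw_pi_xl_le h hA hq.1 hq.2
    _ = ∑ A ∈ C, L.card * (4 * (N.filter fun l => ρ ⊆ A ∪ l).card) := by
        apply Finset.sum_congr rfl
        intro A _
        rw [Finset.sum_product' L N (fun _ l => if ρ ⊆ A ∪ l then 4 else 0), Finset.sum_const, smul_eq_mul]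
        congr 1
        rw [Finset.card_filter, Finset.mul_sum]
        apply Finset.sum_congr rfl
        intro l _
        rw [mul_boole]
    _ = 4 * L.card * (covPairsCL ρ C N).card := by
        rw [card_covPairsCL_eq_sum, Finset.mul_sum]
        apply Finset.sum_congr rfl
        intro A _
        ring

/-- T3 with `covOld`: `≤ 4n·#{j : ν_{p − s_j} > 0 ∨ ν_{p − s_j + 1} > 0}`. -/
theorem sum_pi_xl_le (h : PLTraceData π ρ L C N) :
    ∑ S ∈ piTraces L C, ∑ S' ∈ xlTraces L N, cw (ρ ∪ L) S S' ≤
      4 * L.card * (C.filter fun A => 0 < PL.nu π (π.p - A.card) ∨ 0 < PL.nu π (π.p - A.card + 1)).card :=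
  (sum_pi_xl_le_cov h).trans (Nat.mul_le_mul_left _ (card_covPairsCL_le_covOld h))

/-- T3 reversed, with `#covPairsCL`. -/
theorem sum_xl_pi_le_cov (h : PLTraceData π ρ L C N) :
    ∑ S ∈ xlTraces L N, ∑ S' ∈ piTraces L C, cw (ρ ∪ L) S S' ≤ 4 * L.card * (covPairsCL ρ C N).card := by
  rw [Finset.sum_comm]
  calc ∑ S' ∈ piTraces L C, ∑ S ∈ xlTraces L N, cw (ρ ∪ L) S S'
      = ∑ S' ∈ piTraces L C, ∑ S ∈ xlTraces L N, cw (ρ ∪ L) S' S := by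
        apply Finset.sum_congr rfl
        intro S' _
        apply Finset.sum_congr rfl
        intro S _
        exact cw_comm _ _ _
    _ ≤ _ := sum_pi_xl_le_cov h

/-- T3 reversed. -/
theorem sum_xl_pi_le (h : PLTraceData π ρ L C N) :
    ∑ S ∈ xlTraces L N, ∑ S' ∈ piTraces L C, cw (ρ ∪ L) S S' ≤
      4 * L.card * (C.filter fun A => 0 < PL.nu π (π.p - A.card) ∨ 0 < PL.nu π (π.p - A.card + 1)).card := by
  rw [Finset.sum_comm]
  calc ∑ S' ∈ piTraces L C, ∑ S ∈ xlTraces L N, cw (ρ ∪ L) S S'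
      = ∑ S' ∈ piTraces L C, ∑ S ∈ xlTraces L N, cw (ρ ∪ L) S' S := by
        apply Finset.sum_congr rfl
        intro S' _
        apply Finset.sum_congr rfl
        intro S _
        exact cw_comm _ _ _
    _ ≤ _ := sum_pi_xl_le h

/-- `ρ` is not one of the other listed traces. -/
theorem rho_notMem (h : PLTraceData π ρ L C N) : ρ ∉ piTraces L C ∪ xlTraces L N := by
  rw [Finset.mem_union, not_or]
  obtain ⟨x, hx⟩ := Finset.card_pos.1 (by have := h.three_le; omega : 0 < L.card)
  constructor
  · unfold piTraces
    rw [Finset.mem_image]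
    rintro ⟨A, _, hAρ⟩
    have hxρ : x ∈ ρ := by
      rw [← hAρ]
      exact Finset.mem_union_left _ hx
    exact Finset.disjoint_left.1 h.disj hxρ hx
  · unfold xlTraces
    rw [Finset.mem_image]
    rintro ⟨q, hq, hqρ⟩
    rw [Finset.mem_product] at hq
    have hxρ : q.1 ∈ ρ := by
      rw [← hqρ]
      exact Finset.mem_insert_self _ _
    exact Finset.disjoint_left.1 h.disj hxρ hq.1

/-- The `Π`-traces and the `{x} ∪ λ` traces are different sets (`n ≥ 2`). -/
theorem disjoint_piTraces_xlTraces (h : PLTraceData π ρ L C N) :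
    Disjoint (piTraces L C) (xlTraces L N) := by
  rw [Finset.disjoint_left]
  intro S hS hS'
  unfold piTraces at hS
  unfold xlTraces at hS'
  rw [Finset.mem_image] at hS hS'
  obtain ⟨A, _, rfl⟩ := hS
  obtain ⟨q, hq, hq'⟩ := hS'
  rw [Finset.mem_product] at hq
  have hL : L ⊆ {q.1} := by
    intro y hy
    have hy' : y ∈ insert q.1 q.2 := by
      rw [hq']
      exact Finset.mem_union_left _ hy
    rw [Finset.mem_insert] at hy'
    rw [Finset.mem_singleton]
    rcases hy' with hyx | hyl
    · exact hyx
    · exact absurd hy (Finset.disjoint_left.1 h.disj (h.line_subset _ hq.2 hyl))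
  have h1 := (Finset.card_le_card hL).trans (Finset.card_singleton q.1).le
  have h3 := h.three_le
  omega

/-- **Step (4), the accounting (PRECISION 3 (b))**: on the listed traces of a plane-line normalisation the
covering-pair sum `Σ_{(S, S′)} 2^{|S ∩ S′|}` over ordered pairs of distinct traces covering `G = ρ ∪ L` is at most
`X̄(π)` — T1 + T2 + T3 with the two other shapes contributing `0`. -/
theorem sum_covPairsOf_tracesOf_le_Xbar (h : PLTraceData π ρ L C N) :
    ∑ pp ∈ covPairsOf (tracesOf ρ L C N) (ρ ∪ L), 2 ^ (pp.1 ∩ pp.2).card ≤ PL.Xbar π := by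
  rw [sum_covPairsOf_eq]
  unfold tracesOf
  have hρ := rho_notMem h
  have hAB := disjoint_piTraces_xlTraces h
  simp only [Finset.sum_insert hρ, Finset.sum_union hAB, Finset.sum_add_distrib]
  rw [cw_rho_rho, sum_rho_pi h, sum_rho_xl h, sum_pi_rho h, sum_pi_pi h, sum_xl_rho h, sum_xl_xl h]
  have h1 := sum_pi_xl_le h
  have h2 := sum_xl_pi_le h
  have e1 : (π.sizes.map fun s => 2 ^ s).sum = ∑ A ∈ C, 2 ^ A.card :=
    (PL.sum_card_eq_list h.sizes_eq (fun s => 2 ^ s)).symm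
  have e2 : (π.sizes.filter fun s => 0 < PL.nu π (π.p - s) ∨ 0 < PL.nu π (π.p - s + 1)).length =
      (C.filter fun A => 0 < PL.nu π (π.p - A.card) ∨ 0 < PL.nu π (π.p - A.card + 1)).card :=
    (PL.card_filter_card_eq_list h.sizes_eq (fun s => 0 < PL.nu π (π.p - s) ∨ 0 < PL.nu π (π.p - s + 1))).symm
  unfold PL.Xbar PL.lprime
  rw [e1, e2, h.n_eq]
  omega

/-- **Step (4) composed**: for a family `S` of sets (the rank-3-trace planes) on which `P ↦ P ∩ G` is injective
and whose traces lie among the listed traces of a normalisation with profile `π`, the covering-pair sum of `S` is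
at most `X̄(π)`.  With `S = planes3 M G` (`covPairs3 M G = covPairsOf (planes3 M G) G` by definition) and
`Xcnt_le_sum_covPairs3` this is `Xcnt M G ≤ PL.Xbar (profile D)`. -/
theorem sum_covPairsOf_le_Xbar_of_subset (h : PLTraceData π ρ L C N) {S : Finset (Finset α)}
    (hinj : Set.InjOn (fun P : Finset α => P ∩ (ρ ∪ L)) S)
    (hsub : (S.image fun P => P ∩ (ρ ∪ L)) ⊆ tracesOf ρ L C N) :
    ∑ pp ∈ covPairsOf S (ρ ∪ L), 2 ^ (pp.1 ∩ pp.2 ∩ (ρ ∪ L)).card ≤ PL.Xbar π := by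
  rw [sum_covPairsOf_image_inter hinj]
  exact (sum_covPairsOf_mono hsub (ρ ∪ L)).trans (sum_covPairsOf_tracesOf_le_Xbar h)

end accounting

end PercRepro.SixFour
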